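import Literature.NumberTheory.ComplexMultiplication.CMOrderIdealGeneratorsMaximalOrderBound
import HarnessLib

/-!
# Bass orders: `𝒪_K = S + Sω` ⟹ `gens(S) = 2` ⟹ every over-order has type `1` and is Gorenstein
# (MARSEGLIA 2024 PROPOSITION 4.6, (iv) ⟹ (v) ⟹ (i) ⟹ (ii), (iii); GREITHER 1982 THEOREM 2.3; BASS)

Family `hodge`, lane `lit-hodgefound` (Track 2 foundations library; seat p15, row g29-#2), topic
`Literature/NumberTheory/ComplexMultiplication`, namespaces `Literature.NumberTheory.ComplexMultiplication.EndOrder`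
(§1: any order `𝔯 = endOrder ρ`) and `…CMTypeLattice` (§§2–4: `S = endOrder (M_μ)`, over-orders `T = endOrder (M_ν)`
with `S ≤ T`, `μ ν : Basis ι ℚ K`, `#ι = [K:ℚ]`).  Vocabulary as in g29-#1 `CMOrderIdealGeneratorsMaximalOrderBound`:
the maximal order is the idempotent `M` with `↑M = range (algebraMap (𝓞 K) K)`; «the `S`-module `𝒪_K/S` is cyclic»
(PROP. 4.6 (iv)) is written `↑M = Submodule.span S {1, ω}` («`𝒪_K = S + Sω` for some `ω ∈ 𝒪_K`», Greither's
«`S` is a quadratic extension of `R`», PROP. 1.1: «`[S/mS : R/m]` is at most two»); `gens_S(I) = spanFinrank ↑I`,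
`gens(S) = ⨆_{I ≠ 0} gens_S(I)` (DEF. 4.1); the type of `T` at `𝔔` is `finrank (T ⧸ 𝔔) (↥↑T′ ⧸ 𝔔 • ⊤)` for the
trace dual `↑T′ = traceDual ℤ ℚ ↑1`, `type(T) = ⨆_𝔔 type_𝔔(T)`; «`T` is Gorenstein» is `IsUnit T′` (PROP. 3.4 (3),
`CMOrderCohenMacaulayTypeOne`).  THEOREMS ONLY: no definition, no instance, no named fact (net Literature debt `0`).

## Sources, VERBATIM

S. Marseglia, *Cohen-Macaulay type of orders, generators and ideal classes*, J. Algebra 658 (2024) 247–276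
[Marseglia2024CMType] (held `paper:arxiv-2206.03758`), §4, chunks p0010–p0011: "An order which is either maximal or
satisfies the equivalent conditions of Proposition 4.6 is called a Bass order.  Proposition 4.6. Let `S` be a
non-maximal order. Then the following are equivalent: (i) For every overorder `T` of `S` we have `type(T) = 1`.
(ii) Every overorder of `S` is Gorenstein. (iii) Every fractional `S`-ideal `I` is invertible as a fractional
`(I:I)`-ideal. (iv) The `S`-module `𝒪_K/S` is cyclic. (v) `gens(S) = 2`.  Proof. The equivalence of the first
three statement is a direct consequence of Proposition 3.4. The equivalence of the last four statements can be found
in [LevyWiegand85]."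

C. Greither, *On the two generator problem for the ideals of a one-dimensional ring*, J. Pure Appl. Algebra 24 (1982)
265–276 [Greither1982TwoGenerator] (held `paper:doi-10-1016-0022-4049-82-90044-5`): p. 266 "1.1. Proposition. `R` is
a Q-ring iff `S` is finitely generated over `R` and `[S/mS : R/m]` is at most two."; p. 268 "2.3. THEOREM. Let us say
`R` has binary branching if over every `p ∈ Spec(R)` there are at most two primes of `S`. The following conditions
are equivalent: (a) `R` is a Q-ring, i.e. `S` is a quadratic extension of `R`. (b) `R` has binary branching and is
FD. […] (c) `R` is IG₂, i.e. `v(R)` is at most two. (c′) All local rings of `R` are IG₂. […] (e) Every ring between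
`R` and `S` is Gorenstein.  Proof. […] For the equivalence of (a) and (c), we do not need that theorem: the
equivalence is an immediate corollary to 2.2 (note that `v(R) = 1` implies `R = S`). Every condition of the list,
except (e), manifestly implies that `R` has binary branching."; p. 265 "the IG₂-rings are just those which locally
have multiplicity at most two, or equivalently those `R`, for which `S` is 2-generated as an `R`-module."

## What is formalised (the printed implications, for the order `S = endOrder (M_μ)` and ALL its over-orders)

* §1 (`EndOrder`) **(iv) ⟹ binary branching** («Every condition of the list … manifestly implies that `R` has binary
  branching»): `natCard_quotient_le_natCard_quotient` (`#(𝔯/𝔭) ≤ #(𝒪_K/𝔔)` for a maximal `𝔔 ⊇ 𝔭𝒪_K`: `𝔯/𝔭` embeds),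
  **`binaryBranching_of_coe_eq_span_pair`**: if `𝒪_K = 𝔯 + 𝔯ω` then over every maximal `𝔭` of `𝔯` lie at most two
  primes of `𝒪_K` (three distinct `𝔔ᵢ ⊇ 𝔭𝒪_K` give `#(𝒪_K/(𝔔₁ ∩ 𝔔₂ ∩ 𝔔₃)) = ∏ #(𝒪_K/𝔔ᵢ) ≥ q³` by the Chinese
  remainder theorem, `q = #(𝔯/𝔭)`, while `(s, t) ↦ s + tω : 𝔯 × 𝔯 ↠ 𝒪_K/(𝔔₁ ∩ 𝔔₂ ∩ 𝔔₃)` kills `𝔭 × 𝔭`, so that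
  cardinality divides `q²`).
* §2 **(iv) ⟹ (v) «`gens(S) = 2`»** (GREITHER THM 2.3 (a) ⟹ (c), BASS's «`S` 2-generated ⟹ every ideal
  2-generated»): `spanFinrank_coe_le_two_of_coe_eq_span_pair` (`gens_S(𝒪_K) ≤ 2`),
  `finrank_quotient_smul_top_le_two_of_coe_eq_span_pair` (`dim_{S/𝔭} 𝒪_K/𝔭𝒪_K ≤ 2`, PROP. 1.1),
  **`spanFinrank_coe_le_two_of_coe_eq_span_pair'`** (every fractional `S`-ideal `I ≠ 0` is `2`-generated — g29-#1's
  LEMMA 4.3 under binary branching), `iSup_spanFinrank_coe_le_two_of_coe_eq_span_pair`,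
  **`iSup_spanFinrank_coe_eq_two_of_coe_eq_span_pair`** (`gens(S) = 2` for `S ≠ 𝒪_K`).
* §3 **(v) for `S` ⟹ (v) for every over-order `T ⊇ S`** («`gens_T(I) ≤ gens_S(I)`. Hence `gens(S) = max_T gens(T)`»,
  proof of THM. 4.7): `exists_ne_zero_coe_eq_coe_of_le` (a fractional `T`-ideal is the carrier of a fractional
  `S`-ideal), `spanFinrank_coe_le_spanFinrank_coe_of_le` (`gens_T(I) ≤ gens_S(I)`), **`spanFinrank_coe_le_two_of_le`**.
* §4 **(v) ⟹ (i) ⟹ (ii), (iii) for every over-order `T = endOrder (M_ν) ⊇ S`** (GREITHER THM 2.3 (c) ⟹ (e)):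
  **`iSup_finrank_traceDual_quotient_eq_one_of_le` («(i) `type(T) = 1`»** — `type(T) + 1 ≤ gens(T) ≤ 2` by g28-#5
  when `T ≠ 𝒪_K`, `type(𝒪_K) = 1` otherwise), `forall_finrank_traceDual_quotient_eq_one_of_le` (prime by prime),
  **`isUnit_traceDual_of_le` («(ii) every overorder of `S` is Gorenstein»: `Tᵗ` is invertible)**, and
  **`isUnit_of_div_self_eq_one_of_le` («(iii)»: every fractional `T`-ideal `I′ ≠ 0` with `(I′:I′) = T` is invertible
  in `T`)**; in particular for `T = S` (`hST = le_rfl`).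

NOT here: the base-carrier (`FractionalIdeal S⁰ K`) reading of (ii)/(iii) of `CMOrderBassClifford` («`I·((I:I):I) =
(I:I)`», Clifford) and the converse (i) ⟹ (iv) — next rows.
-/

noncomputable section

open scoped nonZeroDivisors NumberField
open NumberField Module FractionalIdeal
open Submodule (traceDual)

namespace Literature.NumberTheory.ComplexMultiplication

namespace EndOrder

/-! ## §1 (iv) `𝒪_K = 𝔯 + 𝔯ω` ⟹ binary branching at every prime of `𝔯` -/

section BinaryBranching

variable {K : Type} [Field K] [NumberField K]
variable {ι : Type} [Fintype ι] [DecidableEq ι] [Nonempty ι] {ρ : K →ₐ[ℚ] Matrix ι ι ℚ}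

/-- **`#(𝔯/𝔭) ≤ #(𝒪_K/𝔔)` for a maximal ideal `𝔔` of `𝓞 K` over the maximal ideal `𝔭` of the order `𝔯 = endOrder ρ`**: the
residue field `𝔯/𝔭` embeds into `𝒪_K/𝔔` (`𝔔 ∩ 𝔯 = 𝔭`; the summands «`[S/nᵢ : R/m]`» of THEOREM 2.1 are `≥ 1`).
[cite: Greither1982TwoGenerator, §2 Thm. 2.1 (proof: «`[S/mS : R/m] = Σᵢ eᵢ·[S/nᵢ : R/m]`»), p. 267] -/
theorem natCard_quotient_le_natCard_quotient {𝔭 : Ideal (endOrder ρ)} [h𝔭 : 𝔭.IsMaximal] {Q : Ideal (𝓞 K)}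
    (hQ : Q.IsMaximal) (hle : 𝔭.map (toRingOfIntegers ρ) ≤ Q) :
    Nat.card (endOrder ρ ⧸ 𝔭) ≤ Nat.card (𝓞 K ⧸ Q) := by
  have h0 : 𝔭 ≠ ⊥ := Ring.ne_bot_of_isMaximal_of_not_isField h𝔭 not_isField
  have hQ0 : Q ≠ ⊥ := fun h ↦ map_toRingOfIntegers_ne_bot h0 (le_bot_iff.1 (h ▸ hle))
  haveI : Finite (𝓞 K ⧸ Q) := Ideal.finiteQuotientOfFreeOfNeBot Q hQ0
  have hcomap : Q.comap (toRingOfIntegers ρ) = 𝔭 :=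
    (h𝔭.eq_of_le (fun h ↦ hQ.ne_top (by
      rw [Ideal.eq_top_iff_one] at h ⊢
      have h1 := Ideal.mem_comap.1 h
      rwa [map_one] at h1)) (Ideal.map_le_iff_le_comap.1 hle)).symm
  exact Nat.card_le_card_of_injective _
    (Ideal.quotientMap_injective' (f := toRingOfIntegers ρ) (I := Q) (J := 𝔭)
      (H := Ideal.map_le_iff_le_comap.1 hle) hcomap.le)

/-- **PROPOSITION 4.6 (iv) ⟹ BINARY BRANCHING («Every condition of the list, except (e), manifestly implies that `R` has
binary branching», GREITHER THM. 2.3): if `𝒪_K = 𝔯·1 + 𝔯·ω` then among any three maximal ideals of `𝓞 K` over a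
maximal ideal `𝔭` of `𝔯` two coincide.**  Proof: for three distinct `𝔔ᵢ ⊇ 𝔭𝒪_K`, the Chinese remainder theorem gives
`#(𝒪_K/(𝔔₁ ∩ 𝔔₂ ∩ 𝔔₃)) = ∏ #(𝒪_K/𝔔ᵢ) ≥ q³` (`q = #(𝔯/𝔭) ≥ 2`), while `(s, t) ↦ s + tω` is an additive surjection
`𝔯 × 𝔯 ↠ 𝒪_K/(𝔔₁ ∩ 𝔔₂ ∩ 𝔔₃)` vanishing on `𝔭 × 𝔭`, so that cardinality divides `q²`.
[cite: Greither1982TwoGenerator, §2 Thm. 2.3 («`R` has binary branching if over every `p ∈ Spec(R)` there are at most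
two primes of `S`»; (a) ⟹ binary branching) and §1 Prop. 1.1, pp. 266–268] [cite: Marseglia2024CMType, §4 Prop. 4.6
(iv), p. 10] -/
theorem binaryBranching_of_coe_eq_span_pair {M : FractionalIdeal (endOrder ρ)⁰ K}
    (hMO : (M : Set K) = (algebraMap (𝓞 K) K).range) {ω : K}
    (hcyc : (M : Submodule (endOrder ρ) K) = Submodule.span (endOrder ρ) {1, ω})
    (𝔭 : Ideal (endOrder ρ)) [h𝔭 : 𝔭.IsMaximal] :
    ∀ Q₁ Q₂ Q₃ : Ideal (𝓞 K), Q₁.IsMaximal → Q₂.IsMaximal → Q₃.IsMaximal →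
      𝔭.map (toRingOfIntegers ρ) ≤ Q₁ → 𝔭.map (toRingOfIntegers ρ) ≤ Q₂ → 𝔭.map (toRingOfIntegers ρ) ≤ Q₃ →
      Q₁ = Q₂ ∨ Q₁ = Q₃ ∨ Q₂ = Q₃ := by
  intro Q₁ Q₂ Q₃ hQ₁ hQ₂ hQ₃ h₁ h₂ h₃
  by_contra hne
  push Not at hne
  obtain ⟨h12, h13, h23⟩ := hne
  have h0 : 𝔭 ≠ ⊥ := Ring.ne_bot_of_isMaximal_of_not_isField h𝔭 not_isField
  -- a preimage `ω' ∈ 𝓞 K` of `ω ∈ M = 𝒪_K`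
  have hωM : ω ∈ (M : Submodule (endOrder ρ) K) := by
    rw [hcyc]
    exact Submodule.subset_span (by simp)
  have hω0 : ω ∈ (M : Set K) := hωM
  rw [hMO] at hω0
  obtain ⟨ω', hω'⟩ := hω0
  -- the additive map `ψ : S × S → 𝓞 K ⧸ A`, `A = Q₁ ⊓ (Q₂ ⊓ Q₃) ⊇ 𝔭𝓞_K`
  set A : Ideal (𝓞 K) := Q₁ ⊓ (Q₂ ⊓ Q₃) with hA
  have hJA : 𝔭.map (toRingOfIntegers ρ) ≤ A := le_inf h₁ (le_inf h₂ h₃)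
  let ψ : endOrder ρ × endOrder ρ →+ 𝓞 K ⧸ A :=
    { toFun := fun st ↦ Ideal.Quotient.mk A (toRingOfIntegers ρ st.1 + toRingOfIntegers ρ st.2 * ω')
      map_zero' := by simp
      map_add' := fun a b ↦ by
        simp only [Prod.fst_add, Prod.snd_add, map_add, add_mul]
        abel }
  have hψapply : ∀ st : endOrder ρ × endOrder ρ,
      ψ st = Ideal.Quotient.mk A (toRingOfIntegers ρ st.1 + toRingOfIntegers ρ st.2 * ω') := fun _ ↦ rfl
  have hψ : Function.Surjective ψ := by
    intro z
    obtain ⟨a, rfl⟩ := Ideal.Quotient.mk_surjective z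
    have haM : (a : K) ∈ (M : Submodule (endOrder ρ) K) := by
      change (a : K) ∈ (M : Set K)
      rw [hMO]
      exact ⟨a, rfl⟩
    rw [hcyc, Submodule.mem_span_pair] at haM
    obtain ⟨s, t, hst⟩ := haM
    refine ⟨(s, t), ?_⟩
    rw [hψapply]
    congr 1
    apply RingOfIntegers.coe_injective
    change (s : K) + (t : K) * (ω' : K) = (a : K)
    rw [show (ω' : K) = ω from hω', ← hst, Subring.smul_def, Subring.smul_def, smul_eq_mul, smul_eq_mul, mul_one]
  -- `ker ψ ⊇ 𝔭 × 𝔭`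
  have hker : 𝔭.toAddSubgroup.prod 𝔭.toAddSubgroup ≤ ψ.ker := by
    rintro ⟨s, t⟩ ⟨hs, ht⟩
    rw [AddMonoidHom.mem_ker, hψapply, Ideal.Quotient.eq_zero_iff_mem]
    exact A.add_mem (hJA (Ideal.mem_map_of_mem _ hs)) (A.mul_mem_right _ (hJA (Ideal.mem_map_of_mem _ ht)))
  -- `#(𝓞 K ⧸ A) ∣ q²`, `q = #(S/𝔭)`
  have hq : 𝔭.toAddSubgroup.index = Nat.card (endOrder ρ ⧸ 𝔭) := rfl
  have hcardA : Nat.card (𝓞 K ⧸ A) = ψ.ker.index := by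
    rw [AddSubgroup.index_ker, AddMonoidHom.range_eq_top.2 hψ, AddSubgroup.card_top]
  have hdvd : Nat.card (𝓞 K ⧸ A) ∣ Nat.card (endOrder ρ ⧸ 𝔭) * Nat.card (endOrder ρ ⧸ 𝔭) := by
    rw [hcardA, ← hq, ← AddSubgroup.index_prod]
    exact AddSubgroup.index_dvd_of_le hker
  -- CRT: `#(𝓞 K ⧸ A) = #(𝓞 K/Q₁)·#(𝓞 K/Q₂)·#(𝓞 K/Q₃)`
  have hc12 : IsCoprime Q₁ Q₂ := Ideal.isCoprime_iff_sup_eq.2 (hQ₁.coprime_of_ne hQ₂ h12)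
  have hc13 : IsCoprime Q₁ Q₃ := Ideal.isCoprime_iff_sup_eq.2 (hQ₁.coprime_of_ne hQ₃ h13)
  have hc23 : IsCoprime Q₂ Q₃ := Ideal.isCoprime_iff_sup_eq.2 (hQ₂.coprime_of_ne hQ₃ h23)
  have hc1 : IsCoprime Q₁ (Q₂ ⊓ Q₃) := by
    have h := Ideal.isCoprime_iff_sup_eq.1 (hc12.mul_right hc13)
    exact Ideal.isCoprime_iff_sup_eq.2 (top_le_iff.1 (h.ge.trans (sup_le_sup_left Ideal.mul_le_inf _)))
  have hcrt : Nat.card (𝓞 K ⧸ A) = Nat.card (𝓞 K ⧸ Q₁) * (Nat.card (𝓞 K ⧸ Q₂) * Nat.card (𝓞 K ⧸ Q₃)) := by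
    rw [hA, Nat.card_congr (Ideal.quotientInfEquivQuotientProd Q₁ (Q₂ ⊓ Q₃) hc1).toEquiv, Nat.card_prod,
      Nat.card_congr (Ideal.quotientInfEquivQuotientProd Q₂ Q₃ hc23).toEquiv, Nat.card_prod]
  -- `q³ ≤ #(𝓞 K ⧸ A) ≤ q²` with `q ≥ 2`: contradiction
  have hq1 : 1 < Nat.card (endOrder ρ ⧸ 𝔭) := by
    haveI := CMTypeLattice.finite_quotient_endOrder ρ h0
    haveI : Nontrivial (endOrder ρ ⧸ 𝔭) := Ideal.Quotient.nontrivial_iff.2 h𝔭.ne_top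
    exact Finite.one_lt_card
  have hl₁ := natCard_quotient_le_natCard_quotient hQ₁ h₁
  have hl₂ := natCard_quotient_le_natCard_quotient hQ₂ h₂
  have hl₃ := natCard_quotient_le_natCard_quotient hQ₃ h₃
  have hpos : 0 < Nat.card (endOrder ρ ⧸ 𝔭) * Nat.card (endOrder ρ ⧸ 𝔭) := Nat.mul_pos (by omega) (by omega)
  have hle := Nat.le_of_dvd hpos hdvd
  rw [hcrt] at hle
  have h3 : Nat.card (endOrder ρ ⧸ 𝔭) * (Nat.card (endOrder ρ ⧸ 𝔭) * Nat.card (endOrder ρ ⧸ 𝔭)) ≤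
      1 * (Nat.card (endOrder ρ ⧸ 𝔭) * Nat.card (endOrder ρ ⧸ 𝔭)) := by
    rw [one_mul]
    exact (Nat.mul_le_mul hl₁ (Nat.mul_le_mul hl₂ hl₃)).trans hle
  exact absurd (Nat.le_of_mul_le_mul_right h3 hpos) (not_le.2 hq1)

end BinaryBranching

end EndOrder

namespace CMTypeLattice

/-! ## §2 (iv) ⟹ (v): every fractional `S`-ideal is `2`-generated; §3 the same for every over-order; §4 (i), (ii), (iii) -/

section Bass

variable {K : Type} [Field K] [NumberField K]
variable {ι : Type} [Fintype ι] [DecidableEq ι] (μ : Basis ι ℚ K) [Nonempty ι]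
variable [IsFractionRing (endOrder (Algebra.leftMulMatrix μ)) K]

omit [Nonempty ι] [IsFractionRing (endOrder (Algebra.leftMulMatrix μ)) K] in
/-- **«`S` is 2-generated as an `R`-module»: `gens_S(𝒪_K) ≤ 2` when `𝒪_K = S·1 + S·ω`.** [cite: Greither1982TwoGenerator,
§1 Prop. 1.1 and p. 265 («those `R`, for which `S` is 2-generated as an `R`-module»), pp. 265–266]
[cite: Marseglia2024CMType, §4 Prop. 4.6 (iv), p. 10] -/
theorem spanFinrank_coe_le_two_of_coe_eq_span_pair {M : FractionalIdeal (endOrder (Algebra.leftMulMatrix μ))⁰ K}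
    {ω : K} (hcyc : (M : Submodule (endOrder (Algebra.leftMulMatrix μ)) K) =
      Submodule.span (endOrder (Algebra.leftMulMatrix μ)) {1, ω}) :
    (M : Submodule (endOrder (Algebra.leftMulMatrix μ)) K).spanFinrank ≤ 2 := by
  rw [hcyc]
  refine (Submodule.spanFinrank_span_le_ncard_of_finite (Set.toFinite _)).trans ?_
  exact (Set.ncard_insert_le 1 {ω}).trans (by rw [Set.ncard_singleton])

/-- **GREITHER PROP. 1.1, «`R` is a Q-ring iff … `[S/mS : R/m]` is at most two», direction ⟹:
`dim_{S/𝔭} 𝒪_K/𝔭𝒪_K ≤ 2` at every nonzero prime when `𝒪_K = S + Sω`.** [cite: Greither1982TwoGenerator, §1 Prop. 1.1,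
p. 266] -/
theorem finrank_quotient_smul_top_le_two_of_coe_eq_span_pair
    {M : FractionalIdeal (endOrder (Algebra.leftMulMatrix μ))⁰ K}
    {ω : K} (hcyc : (M : Submodule (endOrder (Algebra.leftMulMatrix μ)) K) =
      Submodule.span (endOrder (Algebra.leftMulMatrix μ)) {1, ω})
    {𝔭 : Ideal (endOrder (Algebra.leftMulMatrix μ))} [h𝔭 : 𝔭.IsPrime] (h0 : 𝔭 ≠ ⊥) :
    Module.finrank (endOrder (Algebra.leftMulMatrix μ) ⧸ 𝔭)
        (↥(M : Submodule (endOrder (Algebra.leftMulMatrix μ)) K) ⧸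
          (𝔭 • ⊤ : Submodule (endOrder (Algebra.leftMulMatrix μ)) (M : Submodule (endOrder (Algebra.leftMulMatrix μ)) K))) ≤ 2 :=
  (EndOrder.finrank_quotient_smul_top_le_spanFinrank M h0).trans (spanFinrank_coe_le_two_of_coe_eq_span_pair μ hcyc)

/-- **PROPOSITION 4.6 (iv) ⟹ (v), ideal by ideal: if `𝒪_K = S + Sω` then EVERY nonzero fractional `S`-ideal is generated
by two elements** (GREITHER THM. 2.3 (a) ⟹ (c) «`R` is IG₂, i.e. `v(R)` is at most two», «an immediate corollary to
2.2»; BASS: «`S` is 2-generated as an `R`-module» ⟹ all ideals 2-generated) — g29-#1's LEMMA 4.3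
`gens_S(I) ≤ max{2, gens_S(𝒪_K)}` under the binary branching of §1, with `gens_S(𝒪_K) ≤ 2`.
[cite: Greither1982TwoGenerator, §2 Thm. 2.3 ((a) ⟹ (c)) and Cor. 2.2, p. 268] [cite: Marseglia2024CMType, §4
Prop. 4.6 ((iv) ⟹ (v)), p. 10] -/
theorem spanFinrank_coe_le_two_of_coe_eq_span_pair' {M : FractionalIdeal (endOrder (Algebra.leftMulMatrix μ))⁰ K}
    (hMO : (M : Set K) = (algebraMap (𝓞 K) K).range)
    {ω : K} (hcyc : (M : Submodule (endOrder (Algebra.leftMulMatrix μ)) K) =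
      Submodule.span (endOrder (Algebra.leftMulMatrix μ)) {1, ω})
    {I : FractionalIdeal (endOrder (Algebra.leftMulMatrix μ))⁰ K} (hI : I ≠ 0) :
    (I : Submodule (endOrder (Algebra.leftMulMatrix μ)) K).spanFinrank ≤ 2 :=
  (spanFinrank_coe_le_max_of_binaryBranching μ hMO (fun 𝔭 _ ↦ by
    haveI := 𝔭.isMaximal
    exact EndOrder.binaryBranching_of_coe_eq_span_pair hMO hcyc 𝔭.asIdeal) hI).trans
    (max_le le_rfl (spanFinrank_coe_le_two_of_coe_eq_span_pair μ hcyc))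

/-- **`gens(S) ≤ 2` when `𝒪_K = S + Sω`** (DEFINITION 4.1's supremum). [cite: Marseglia2024CMType, §4 Prop. 4.6 ((iv) ⟹ (v)),
Def. 4.1, p. 10] [cite: Greither1982TwoGenerator, §2 Thm. 2.3 ((a) ⟹ (c)), p. 268] -/
theorem iSup_spanFinrank_coe_le_two_of_coe_eq_span_pair {M : FractionalIdeal (endOrder (Algebra.leftMulMatrix μ))⁰ K}
    (hMO : (M : Set K) = (algebraMap (𝓞 K) K).range)
    {ω : K} (hcyc : (M : Submodule (endOrder (Algebra.leftMulMatrix μ)) K) =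
      Submodule.span (endOrder (Algebra.leftMulMatrix μ)) {1, ω}) :
    ⨆ I : {I : FractionalIdeal (endOrder (Algebra.leftMulMatrix μ))⁰ K // I ≠ 0},
        ((I : FractionalIdeal (endOrder (Algebra.leftMulMatrix μ))⁰ K) :
          Submodule (endOrder (Algebra.leftMulMatrix μ)) K).spanFinrank ≤ 2 := by
  haveI : Nonempty {I : FractionalIdeal (endOrder (Algebra.leftMulMatrix μ))⁰ K // I ≠ 0} := ⟨⟨1, one_ne_zero⟩⟩
  exact ciSup_le fun I ↦ spanFinrank_coe_le_two_of_coe_eq_span_pair' μ hMO hcyc I.2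

/-- **MARSEGLIA 2024 PROPOSITION 4.6, (iv) ⟹ (v): for a NON-MAXIMAL order `S` with `𝒪_K = S + Sω`, `gens(S) = 2`**
(`≤ 2` above; `≥ 2` since `S ≠ 𝒪_K`, g28-#5's `two_le_iSup_spanFinrank`). [cite: Marseglia2024CMType, §4 Prop. 4.6
((iv) ⟹ (v)), p. 10] [cite: Greither1982TwoGenerator, §2 Thm. 2.3 ((a) ⟺ (c)), p. 268] -/
theorem iSup_spanFinrank_coe_eq_two_of_coe_eq_span_pair {M : FractionalIdeal (endOrder (Algebra.leftMulMatrix μ))⁰ K}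
    (hMO : (M : Set K) = (algebraMap (𝓞 K) K).range)
    {ω : K} (hcyc : (M : Submodule (endOrder (Algebra.leftMulMatrix μ)) K) =
      Submodule.span (endOrder (Algebra.leftMulMatrix μ)) {1, ω})
    (hS : ∃ a : 𝓞 K, (a : K) ∉ endOrder (Algebra.leftMulMatrix μ)) :
    ⨆ I : {I : FractionalIdeal (endOrder (Algebra.leftMulMatrix μ))⁰ K // I ≠ 0},
        ((I : FractionalIdeal (endOrder (Algebra.leftMulMatrix μ))⁰ K) :
          Submodule (endOrder (Algebra.leftMulMatrix μ)) K).spanFinrank = 2 :=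
  le_antisymm (iSup_spanFinrank_coe_le_two_of_coe_eq_span_pair μ hMO hcyc) (two_le_iSup_spanFinrank μ hS)

omit [Nonempty ι] [IsFractionRing (endOrder (Algebra.leftMulMatrix μ)) K] in
/-- **«Note that for every `T ∈ 𝒮`, every fractional `T`-ideal `I` is also a fractional `S`-ideal»**: for over-orders
`S = endOrder (M_μ) ≤ T = endOrder (M_ν)`, every nonzero fractional `T`-ideal is the carrier of a nonzero fractional
`S`-ideal (its `ℤ`-basis spans a lattice whose order contains `T ⊇ S`). [cite: Marseglia2024CMType, §4 Thm. 4.7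
(proof), p. 11] -/
theorem exists_ne_zero_coe_eq_coe_of_le {ν : Basis ι ℚ K}
    (hST : endOrder (Algebra.leftMulMatrix μ) ≤ endOrder (Algebra.leftMulMatrix ν))
    {I' : FractionalIdeal (endOrder (Algebra.leftMulMatrix ν))⁰ K} (hI' : I' ≠ 0) :
    ∃ I : FractionalIdeal (endOrder (Algebra.leftMulMatrix μ))⁰ K, I ≠ 0 ∧
      (I : Set K) = (I' : Set K) := by
  obtain ⟨ν', hν'⟩ := exists_basis_span_eq_restrictScalars_coe ν hI'
  have hle : endOrder (Algebra.leftMulMatrix μ) ≤ endOrder (Algebra.leftMulMatrix ν') := by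
    intro α hα
    rw [mem_endOrder_leftMulMatrix_iff_forall]
    intro x hx
    rw [hν', Submodule.restrictScalars_mem, mem_coe] at hx ⊢
    have h := Submodule.smul_mem (I' : Submodule (endOrder (Algebra.leftMulMatrix ν)) K)
      (⟨α, hST hα⟩ : endOrder (Algebra.leftMulMatrix ν)) hx
    rwa [Subring.smul_def, smul_eq_mul, mem_coe] at h
  obtain ⟨I, hI0, hI⟩ := exists_fractionalIdeal_coe_eq (Algebra.leftMulMatrix μ) ν' hle
  refine ⟨I, hI0, ?_⟩
  rw [hI, hν', Submodule.coe_restrictScalars, coeToSet_coeToSubmodule]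

omit [IsFractionRing (endOrder (Algebra.leftMulMatrix μ)) K] in
/-- **«So we have `gens_T(I) ≤ gens_S(I)`»**: a generating set over `S` generates over the over-order `T ⊇ S`.
[cite: Marseglia2024CMType, §4 Thm. 4.7 (proof), p. 11] -/
theorem spanFinrank_coe_le_spanFinrank_coe_of_le {ν : Basis ι ℚ K}
    (hST : endOrder (Algebra.leftMulMatrix μ) ≤ endOrder (Algebra.leftMulMatrix ν))
    {I' : FractionalIdeal (endOrder (Algebra.leftMulMatrix ν))⁰ K}
    {I : FractionalIdeal (endOrder (Algebra.leftMulMatrix μ))⁰ K} (h : (I : Set K) = (I' : Set K)) :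
    (I' : Submodule (endOrder (Algebra.leftMulMatrix ν)) K).spanFinrank ≤
      (I : Submodule (endOrder (Algebra.leftMulMatrix μ)) K).spanFinrank := by
  haveI := isNoetherianRing_endOrder (Algebra.leftMulMatrix μ)
  obtain ⟨G, hGcard, hGspan⟩ := Submodule.FG.exists_span_finset_card_eq_spanFinrank
    (fg_of_isNoetherianRing le_rfl I :
      ((I : FractionalIdeal (endOrder (Algebra.leftMulMatrix μ))⁰ K) : Submodule (endOrder (Algebra.leftMulMatrix μ)) K).FG)
  have hmem : ∀ x : K, x ∈ (I : Submodule (endOrder (Algebra.leftMulMatrix μ)) K) ↔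
      x ∈ (I' : Submodule (endOrder (Algebra.leftMulMatrix ν)) K) := fun x ↦ by
    rw [mem_coe, mem_coe, ← SetLike.mem_coe, h, SetLike.mem_coe]
  have hspanT : Submodule.span (endOrder (Algebra.leftMulMatrix ν)) (G : Set K) =
      (I' : Submodule (endOrder (Algebra.leftMulMatrix ν)) K) := by
    refine le_antisymm (Submodule.span_le.2 fun g hg ↦ ?_) fun x hx ↦ ?_
    · have hg' : g ∈ (I : Submodule (endOrder (Algebra.leftMulMatrix μ)) K) := hGspan ▸ Submodule.subset_span hg
      exact (hmem g).1 hg'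
    · have hx' : x ∈ Submodule.span (endOrder (Algebra.leftMulMatrix μ)) (G : Set K) := by
        rw [hGspan]
        exact (hmem x).2 hx
      clear hx
      induction hx' using Submodule.span_induction with
      | mem y hy => exact Submodule.subset_span hy
      | zero => exact Submodule.zero_mem _
      | add y z _ _ hy hz => exact Submodule.add_mem _ hy hz
      | smul s y _ hy =>
        have e : s • y = (⟨(s : K), hST s.2⟩ : endOrder (Algebra.leftMulMatrix ν)) • y := by
          rw [Subring.smul_def, Subring.smul_def]
        rw [e]
        exact Submodule.smul_mem _ _ hy
  rw [← hspanT, ← hGcard]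
  exact (Submodule.spanFinrank_span_le_ncard_of_finite G.finite_toSet).trans (by rw [Set.ncard_coe_finset])

/-- **(v) for `S` passes to every over-order: if `𝒪_K = S + Sω` then every nonzero fractional ideal of every over-order
`T = endOrder (M_ν) ⊇ S` is generated by two elements** («Hence `gens(S) = max_{T ∈ 𝒮} gens(T)`»; GREITHER THM. 2.3
(c) for every ring between `R` and `S`). [cite: Marseglia2024CMType, §4 Thm. 4.7 (proof) and Prop. 4.6 (v), pp. 10–11]
[cite: Greither1982TwoGenerator, §2 Thm. 2.3, p. 268] -/
theorem spanFinrank_coe_le_two_of_le {M : FractionalIdeal (endOrder (Algebra.leftMulMatrix μ))⁰ K}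
    (hMO : (M : Set K) = (algebraMap (𝓞 K) K).range)
    {ω : K} (hcyc : (M : Submodule (endOrder (Algebra.leftMulMatrix μ)) K) =
      Submodule.span (endOrder (Algebra.leftMulMatrix μ)) {1, ω})
    {ν : Basis ι ℚ K} (hST : endOrder (Algebra.leftMulMatrix μ) ≤ endOrder (Algebra.leftMulMatrix ν))
    {I' : FractionalIdeal (endOrder (Algebra.leftMulMatrix ν))⁰ K} (hI' : I' ≠ 0) :
    (I' : Submodule (endOrder (Algebra.leftMulMatrix ν)) K).spanFinrank ≤ 2 := by
  obtain ⟨I, hI0, hI⟩ := exists_ne_zero_coe_eq_coe_of_le μ hST hI'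
  exact (spanFinrank_coe_le_spanFinrank_coe_of_le μ hST hI).trans
    (spanFinrank_coe_le_two_of_coe_eq_span_pair' μ hMO hcyc hI0)

/-- **MARSEGLIA 2024 PROPOSITION 4.6, (iv) ⟹ (i): if `𝒪_K = S + Sω` then «for every overorder `T` of `S` we have
`type(T) = 1`»**, for every presentation `T = endOrder (M_ν) ⊇ S` and its trace dual `↑T′ = Tᵗ` (for `T ≠ 𝒪_K`:
`type(T) + 1 ≤ gens(T) ≤ 2` by g28-#5's THEOREM 4.7 (i)-vs-(v) step and §3; `type(𝒪_K) = 1`).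
[cite: Marseglia2024CMType, §4 Prop. 4.6 ((v) ⟹ (i) through Thm. 4.7), pp. 10–11] [cite: Greither1982TwoGenerator,
§2 Thm. 2.1 («multiplicity at most two») and Thm. 2.3 ((c) ⟹ (e)), pp. 267–268] -/
theorem iSup_finrank_traceDual_quotient_eq_one_of_le {M : FractionalIdeal (endOrder (Algebra.leftMulMatrix μ))⁰ K}
    (hMO : (M : Set K) = (algebraMap (𝓞 K) K).range)
    {ω : K} (hcyc : (M : Submodule (endOrder (Algebra.leftMulMatrix μ)) K) =
      Submodule.span (endOrder (Algebra.leftMulMatrix μ)) {1, ω})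
    {ν : Basis ι ℚ K} (hST : endOrder (Algebra.leftMulMatrix μ) ≤ endOrder (Algebra.leftMulMatrix ν))
    [IsFractionRing (endOrder (Algebra.leftMulMatrix ν)) K]
    {T' : FractionalIdeal (endOrder (Algebra.leftMulMatrix ν))⁰ K}
    (hT' : (T' : Submodule (endOrder (Algebra.leftMulMatrix ν)) K) =
      traceDual ℤ ℚ ((1 : FractionalIdeal (endOrder (Algebra.leftMulMatrix ν))⁰ K) :
        Submodule (endOrder (Algebra.leftMulMatrix ν)) K)) :
    ⨆ 𝔔 : MaximalSpectrum (endOrder (Algebra.leftMulMatrix ν)),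
        Module.finrank (endOrder (Algebra.leftMulMatrix ν) ⧸ 𝔔.asIdeal)
          ((T' : Submodule (endOrder (Algebra.leftMulMatrix ν)) K) ⧸
            (𝔔.asIdeal • ⊤ : Submodule (endOrder (Algebra.leftMulMatrix ν))
              (T' : Submodule (endOrder (Algebra.leftMulMatrix ν)) K))) = 1 := by
  by_cases hS' : ∃ a : 𝓞 K, (a : K) ∉ endOrder (Algebra.leftMulMatrix ν)
  · have h := iSup_finrank_traceDual_quotient_add_one_le_iSup_spanFinrank ν hT' hS'
    haveI : Nonempty {I' : FractionalIdeal (endOrder (Algebra.leftMulMatrix ν))⁰ K // I' ≠ 0} := ⟨⟨1, one_ne_zero⟩⟩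
    have h2 : ⨆ I' : {I' : FractionalIdeal (endOrder (Algebra.leftMulMatrix ν))⁰ K // I' ≠ 0},
        ((I' : FractionalIdeal (endOrder (Algebra.leftMulMatrix ν))⁰ K) :
          Submodule (endOrder (Algebra.leftMulMatrix ν)) K).spanFinrank ≤ 2 :=
      ciSup_le fun I' ↦ spanFinrank_coe_le_two_of_le μ hMO hcyc hST I'.2
    have h1 := one_le_iSup_finrank_traceDual_quotient ν hT'
    omega
  · push Not at hS'
    exact iSup_finrank_traceDual_quotient_eq_one_of_forall_mem ν hT' hS'

/-- **… prime by prime: `type_𝔔(T) = 1` at every prime `𝔔` of every over-order `T ⊇ S` when `𝒪_K = S + Sω`.**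
[cite: Marseglia2024CMType, §4 Prop. 4.6 (i) and §3 Prop. 3.4 ((1)⟺(2)), pp. 9–10] -/
theorem forall_finrank_traceDual_quotient_eq_one_of_le {M : FractionalIdeal (endOrder (Algebra.leftMulMatrix μ))⁰ K}
    (hMO : (M : Set K) = (algebraMap (𝓞 K) K).range)
    {ω : K} (hcyc : (M : Submodule (endOrder (Algebra.leftMulMatrix μ)) K) =
      Submodule.span (endOrder (Algebra.leftMulMatrix μ)) {1, ω})
    {ν : Basis ι ℚ K} (hST : endOrder (Algebra.leftMulMatrix μ) ≤ endOrder (Algebra.leftMulMatrix ν))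
    [IsFractionRing (endOrder (Algebra.leftMulMatrix ν)) K]
    {T' : FractionalIdeal (endOrder (Algebra.leftMulMatrix ν))⁰ K}
    (hT' : (T' : Submodule (endOrder (Algebra.leftMulMatrix ν)) K) =
      traceDual ℤ ℚ ((1 : FractionalIdeal (endOrder (Algebra.leftMulMatrix ν))⁰ K) :
        Submodule (endOrder (Algebra.leftMulMatrix ν)) K))
    (𝔔 : MaximalSpectrum (endOrder (Algebra.leftMulMatrix ν))) :
    Module.finrank (endOrder (Algebra.leftMulMatrix ν) ⧸ 𝔔.asIdeal)
        ((T' : Submodule (endOrder (Algebra.leftMulMatrix ν)) K) ⧸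
          (𝔔.asIdeal • ⊤ : Submodule (endOrder (Algebra.leftMulMatrix ν))
            (T' : Submodule (endOrder (Algebra.leftMulMatrix ν)) K))) = 1 :=
  (iSup_finrank_traceDual_quotient_eq_one_iff ν hT').1 (iSup_finrank_traceDual_quotient_eq_one_of_le μ hMO hcyc hST hT') 𝔔

/-- **MARSEGLIA 2024 PROPOSITION 4.6, (iv) ⟹ (ii): if `𝒪_K = S + Sω` then «every overorder of `S` is Gorenstein» —
the trace dual `Tᵗ` of every over-order `T = endOrder (M_ν) ⊇ S` is invertible** (PROP. 3.4 (2) ⟹ (3)); GREITHER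
THM. 2.3 (a) ⟹ (e) «Every ring between `R` and `S` is Gorenstein». [cite: Marseglia2024CMType, §4 Prop. 4.6
((i) ⟺ (ii) «a direct consequence of Proposition 3.4»), p. 10] [cite: Greither1982TwoGenerator, §2 Thm. 2.3 ((a) ⟹ (e)),
p. 268] -/
theorem isUnit_traceDual_of_le {M : FractionalIdeal (endOrder (Algebra.leftMulMatrix μ))⁰ K}
    (hMO : (M : Set K) = (algebraMap (𝓞 K) K).range)
    {ω : K} (hcyc : (M : Submodule (endOrder (Algebra.leftMulMatrix μ)) K) =
      Submodule.span (endOrder (Algebra.leftMulMatrix μ)) {1, ω})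
    {ν : Basis ι ℚ K} (hST : endOrder (Algebra.leftMulMatrix μ) ≤ endOrder (Algebra.leftMulMatrix ν))
    [IsFractionRing (endOrder (Algebra.leftMulMatrix ν)) K]
    {T' : FractionalIdeal (endOrder (Algebra.leftMulMatrix ν))⁰ K}
    (hT' : (T' : Submodule (endOrder (Algebra.leftMulMatrix ν)) K) =
      traceDual ℤ ℚ ((1 : FractionalIdeal (endOrder (Algebra.leftMulMatrix ν))⁰ K) :
        Submodule (endOrder (Algebra.leftMulMatrix ν)) K)) :
    IsUnit T' :=
  (forall_finrank_traceDual_quotient_eq_one_iff_isUnit ν hT').1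
    (forall_finrank_traceDual_quotient_eq_one_of_le μ hMO hcyc hST hT')

/-- **MARSEGLIA 2024 PROPOSITION 4.6, (iv) ⟹ (iii): if `𝒪_K = S + Sω` then every nonzero fractional ideal `I′` of an
over-order `T = endOrder (M_ν) ⊇ S` with `(I′:I′) = T` is invertible in `T`** (PROP. 3.4 (2) ⟹ (4) for `T`; applied to
`T = (I:I)` this is «every fractional `S`-ideal `I` is invertible as a fractional `(I:I)`-ideal»).
[cite: Marseglia2024CMType, §4 Prop. 4.6 ((i) ⟺ (iii)), p. 10; §3 Prop. 3.4, p. 9] -/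
theorem isUnit_of_div_self_eq_one_of_le {M : FractionalIdeal (endOrder (Algebra.leftMulMatrix μ))⁰ K}
    (hMO : (M : Set K) = (algebraMap (𝓞 K) K).range)
    {ω : K} (hcyc : (M : Submodule (endOrder (Algebra.leftMulMatrix μ)) K) =
      Submodule.span (endOrder (Algebra.leftMulMatrix μ)) {1, ω})
    {ν : Basis ι ℚ K} (hST : endOrder (Algebra.leftMulMatrix μ) ≤ endOrder (Algebra.leftMulMatrix ν))
    [IsFractionRing (endOrder (Algebra.leftMulMatrix ν)) K]
    {I' : FractionalIdeal (endOrder (Algebra.leftMulMatrix ν))⁰ K} (hI' : I' ≠ 0) (hII : I' / I' = 1) :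
    IsUnit I' := by
  obtain ⟨T', -, hT'⟩ := exists_coe_eq_traceDual ν
    (one_ne_zero' (FractionalIdeal (endOrder (Algebra.leftMulMatrix ν))⁰ K))
  exact (forall_finrank_traceDual_quotient_eq_one_iff_forall_isUnit ν hT').1
    (forall_finrank_traceDual_quotient_eq_one_of_le μ hMO hcyc hST hT') I' hI' hII

end Bass

end CMTypeLattice

end Literature.NumberTheory.ComplexMultiplication
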